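import Literature.Geometry.Kaehler.ComplexTorusVerySimpleFixedPoints
import Literature.Geometry.Kaehler.ComplexTorusIsotypicalDecomposition
import Literature.Geometry.Kaehler.ComplexTorusPoincareCompleteReducibilityPowers
import Mathlib.Data.Matrix.PEquiv
import HarnessLib

/-!
# The second alternative of Dolgachev–Zarhin's Theorem 2.18: `X ∼ B^r` with `ℚ(ζ_ℓ) ↪ End_ℚ(B)`, `2 dim B = ℓ - 1`

Layer `Literature/Geometry/Kaehler`, namespace `Literature.Geometry.Kaehler.ComplexTorus`; lane
`lit-hodgefound` (Track 2 foundations library), row g13-#1 of seat p11 (gen 13), FILE 3 — the sequel of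
`ComplexTorusVerySimpleFixedPoints.lean` (FILE 2: Theorem 2.18 at torus level, whose second alternative
ends with "`End_ℚ(A)_δ` is the commutant of `δ` in `M_ι(ℚ)`, `≅ Mat_r(ℚ[δ])`"). THEOREMS ONLY (no
definition, no named fact; net debt 0).

## Sources READ (held texts), verbatim

I. Dolgachev, Yu. G. Zarhin, *Endomorphisms of Complex Abelian Varieties* (2024; bib `DolgachevZarhin2024`;
held text `paper:galaxy-pdf-8712177384607648460`), §2.2 Theorem 2.18, last sentence (chunk p0036):
"In the latter case, `A` is isogenous to a self-product `B^r` of a `(ℓ - 1)/2`-dimensional abelian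
variety `B` with `End_ℚ(B) ≅ ℚ(ζ_ℓ)`." — NO PROOF in the held draft (p0037 breaks off after "By Remark
2.17, `End_δ(A) = End_{ℤ[δ]}(Λ)`").

Yu. G. Zarhin, *Cyclic covers of the projective line, their jacobians and endomorphisms*, J. reine angew.
Math. 544 (2002) (bib `Zarhin2002CyclicCovers`; held text `paper:arxiv-math_0008134`, p0007), the published
form of this step: "**Lemma 3.7.** Assume that `Λ_ℚ` is a central simple `ℚ(δ_p)`-algebra of dimension
`(2g/(p-1))²`. Then there exist a `(p-1)/2`-dimensional abelian variety `Z` over `K_a`, a positive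
integer `r`, an embedding `ℚ(ζ_p) ≅ ℚ(δ_p) ↪ End⁰(Z)` and an isogeny `φ : Z^r → J^{(f,p)}` such that the
induced isomorphism `Mat_r(End⁰(Z)) = End⁰(Z^r) ≅ End⁰(J^{(f,p)})` […] maps identically `ℚ(δ_p) ⊂ End⁰(Z)
⊂ Mat_r(End⁰(Z))` onto `ℚ(δ_p) ⊂ End⁰(J^{(f,p)})`. […] *Proof.* Clearly, there exist a positive integer
`r` and a central division algebra `H` over `ℚ(δ_p) ≅ ℚ(ζ_p)` such that `Λ_ℚ ≅ Mat_r(H)`. This implies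
that there exist an abelian variety `Z` over `K_a` with `ℚ(δ_p) ⊂ H ⊂ End⁰(Z)` and an isogeny
`φ : Z^r → J^{(f,p)}` […]. We still have to check that `2 dim(Z) = p - 1`. […] This implies that
`p - 1 = [ℚ(δ_p) : ℚ]` divides `2 dim(Z)` and therefore `2 dim(Z) = p - 1`."

The mechanism (the tree's `ComplexTorusIsotypicalDecomposition`, Lange–Recillas 2004 §1 Prop. 1.1 (b),
§2 Prop. 2.1): complete orthogonal idempotents of `End_ℚ(X)` give an isogeny `∏ X^{e_i} → X`, and
conjugate idempotents have isogenous images; `rk Λ(X^ε) = Tr(ε)` (Lange 2023, Cor. 2.4.28).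

## Statement formalised (the part of the printed sentence that the sources prove), and the deviation

For `X = E/Φ(ℤ^ι)` of positive dimension, `ℓ` prime, `D ∈ M_ι(ℤ)` with `Φ_ℓ(D) = 0`, IN THE SECOND
ALTERNATIVE of Theorem 2.18 — encoded by its conclusion "every rational matrix commuting with `D_ℚ` lies
in `End_ℚ(X)`" (`Subalgebra.centralizer ℚ {D_ℚ} ≤ endAlgRat Φ`, FILE 2's
`centralizer_le_endAlgRat_of_fixedImage_eq_top`) — there is an idempotent `e ∈ End_ℚ(X)` commuting
with `δ` such that, with `B := X^e` (`idemPeriod Φ e`) and `r = rk Λ/(ℓ - 1) = 2 dim X/(ℓ - 1)`: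
`X ∼ B^r` (`IsIsogenous Φ (powPeriod (idemPeriod Φ e) r)`), `rk Λ(B) = ℓ - 1` (so `2 dim B = ℓ - 1`),
and `δ|_B ∈ End_ℚ(B)` satisfies `Φ_ℓ(δ|_B) = 0` (so `ℚ(ζ_ℓ) ≅ ℚ[t]/(Φ_ℓ) ≅ ℚ[δ|_B] ⊆ End_ℚ(B)`, and
`ℚ[δ|_B]` is its own commutant in `End_ℚ(Λ(B) ⊗ ℚ)`, hence a maximal commutative subalgebra of
`End_ℚ(B)`) — `exists_isIsogenous_powPeriod_of_centralizer_le`, `…_of_fixedImage_eq_top`. The matrix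
units `E_{ii}` of `Mat_r(ℚ[δ]) ≅ End_ℚ(X)_δ` (FILE 1/FILE 2) are complete orthogonal idempotents of
`End_ℚ(X)`, pairwise conjugate by the permutation matrices of transpositions (units of `End_ℚ(X)_δ`), so
`X ∼ ∏_i X^{E_{ii}} ∼ (X^{E_{11}})^r`; their traces agree and sum to `rk Λ`, so `rk Λ(X^{E_{11}}) =
Tr(E_{11}) = rk Λ / r = ℓ - 1`.

`DEVIATION / NOT formalised`: the printed "`End_ℚ(B) ≅ ℚ(ζ_ℓ)`" is NOT proved in the held draft and is
not asserted here; what the published argument (Zarhin 2002, Lemma 3.7) gives — and what is proved — is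
`ℚ(ζ_ℓ) ↪ End_ℚ(B)` with `[ℚ(ζ_ℓ) : ℚ] = 2 dim B`, whence `ℚ(ζ_ℓ)` is a maximal commutative
subalgebra of `End_ℚ(B)` (`B` has complex multiplication by `ℚ(ζ_ℓ)`).
`-- TODO(Thm 2.18, "End_ℚ(B) ≅ ℚ(ζ_ℓ)"): not in the source's proof; needs more than the torus-level hypotheses.`

## References

* [DolgachevZarhin2024] I. Dolgachev, Yu. G. Zarhin, *Endomorphisms of Complex Abelian Varieties* (2024),
  §2.2 Theorem 2.18 (chunk p0036).
* [Zarhin2002CyclicCovers] Yu. G. Zarhin, *Cyclic covers of the projective line, their jacobians and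
  endomorphisms*, J. reine angew. Math. 544 (2002), §3 Lemma 3.7 (p0007).
* [LangeRecillas2004] H. Lange, S. Recillas, *Abelian varieties with group action*, J. reine angew. Math.
  575 (2004), §1 Prop. 1.1, §2 Prop. 2.1 (the tree's isogeny decomposition along idempotents).
* [Lange2023AbelianVarietiesComplex] H. Lange, *Abelian Varieties over the Complex Numbers* (2023), §2.4.4
  Cor. 2.4.28 (`dim X^ε = Tr(ε)`).
-/

noncomputable section

open Module Matrix Function Polynomial
open Literature.LinearAlgebra.Matrix

namespace Literature.Geometry.Kaehler

namespace ComplexTorus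

open CyclotomicIdempotents

/-! ### §1 Matrix units: complete orthogonal idempotents, conjugate under transpositions -/

section MatrixUnits

variable {n : Type*} [Fintype n] [DecidableEq n] {R : Type*} [Ring R]

/-- The diagonal matrix units `E_{ii}` are complete orthogonal idempotents of `Mat_n(R)`.
[cite: Zarhin2002CyclicCovers, §3 Lemma 3.7 (proof: "`Λ_ℚ ≅ Mat_r(H)` … an isogeny `φ : Z^r → J`", p0007)] -/
theorem completeOrthogonalIdempotents_single_diag :
    CompleteOrthogonalIdempotents fun i : n ↦ Matrix.single i i (1 : R) where
  idem i := by
    change Matrix.single i i (1 : R) * Matrix.single i i 1 = Matrix.single i i 1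
    rw [Matrix.single_mul_single_same, mul_one]
  ortho i j hij := by
    change Matrix.single i i (1 : R) * Matrix.single j j 1 = 0
    exact Matrix.single_mul_single_of_ne 1 i i j hij 1
  complete := by
    ext a b
    rw [Matrix.sum_apply, Matrix.one_apply]
    simp only [Matrix.single_apply]
    by_cases hab : a = b
    · subst hab
      rw [Finset.sum_eq_single a (fun c _ hc ↦ by rw [if_neg (fun h ↦ hc h.1)]) (by simp), if_pos ⟨rfl, rfl⟩,
        if_pos rfl]
    · rw [if_neg hab]
      exact Finset.sum_eq_zero fun c _ ↦ if_neg fun h ↦ hab (h.1.symm.trans h.2)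

/-- The permutation matrix of the transposition `(i j)` is an involution. [folklore] -/
private theorem swap_toMatrix_mul_self (i j : n) :
    ((Equiv.swap i j).toPEquiv.toMatrix : Matrix n n R) * (Equiv.swap i j).toPEquiv.toMatrix = 1 := by
  rw [PEquiv.toMatrix_toPEquiv_mul, PEquiv.toMatrix_toPEquiv_eq, Matrix.submatrix_submatrix]
  have h : ((Equiv.swap i j : n → n) ∘ (Equiv.swap i j : n → n)) = id :=
    funext fun x ↦ Equiv.swap_apply_self i j x
  rw [h, Function.comp_id, Matrix.submatrix_id_id]

/-- Conjugating `E_{jj}` by the transposition `(i j)` gives `E_{ii}`. [folklore] -/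
private theorem swap_toMatrix_mul_single_mul (i j : n) :
    ((Equiv.swap i j).toPEquiv.toMatrix : Matrix n n R) * Matrix.single j j (1 : R) *
        (Equiv.swap i j).toPEquiv.toMatrix = Matrix.single i i 1 := by
  rw [Matrix.mul_assoc, PEquiv.mul_toMatrix_toPEquiv, PEquiv.toMatrix_toPEquiv_mul, Matrix.submatrix_submatrix,
    Function.comp_id, Function.id_comp, Equiv.symm_swap]
  ext a b
  simp only [Matrix.submatrix_apply, Matrix.single_apply]
  have ha : Equiv.swap i j a = j ↔ a = i := by
    rw [Equiv.swap_apply_eq_iff, Equiv.swap_apply_right]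
  have hb : Equiv.swap i j b = j ↔ b = i := by
    rw [Equiv.swap_apply_eq_iff, Equiv.swap_apply_right]
  simp only [eq_comm (a := j), eq_comm (a := i), ha, hb]

/-- **Every diagonal matrix unit is conjugate to `E_{i₀i₀}` by a unit** (the permutation matrix of a
transposition). [folklore] -/
private theorem exists_unit_single_eq_conj (i₀ i : n) :
    ∃ u : (Matrix n n R)ˣ, Matrix.single i i (1 : R) = (u : Matrix n n R) * Matrix.single i₀ i₀ 1 * (↑u⁻¹ : Matrix n n R) := by
  refine ⟨⟨(Equiv.swap i i₀).toPEquiv.toMatrix, (Equiv.swap i i₀).toPEquiv.toMatrix,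
    swap_toMatrix_mul_self i i₀, swap_toMatrix_mul_self i i₀⟩, ?_⟩
  exact (swap_toMatrix_mul_single_mul i i₀).symm

end MatrixUnits

/-! ### §2 Transport into `End_ℚ(X)`: `X ∼ (X^{e₁})^r`, all `X^{e_i}` of the same rank -/

section Transport

variable {ι : Type*} [Fintype ι] [DecidableEq ι] {E : Type*} [NormedAddCommGroup E] [NormedSpace ℂ E]
  (Φ : (ι → ℝ) ≃L[ℝ] E)

/-- **`X ∼ (X^{e_{i₀}})^r`** for complete orthogonal idempotents `e_i ∈ End_ℚ(X)`, `i ∈ Fin r`, which are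
pairwise conjugate by units of `End_ℚ(X)` ("`Λ_ℚ ≅ Mat_r(H)` … an isogeny `φ : Z^r → J`"; Lange–Recillas:
`∏ X^{e_i} ∼ X` and conjugate idempotents have isogenous images).
[cite: Zarhin2002CyclicCovers, §3 Lemma 3.7 (proof, p0007)] [cite: LangeRecillas2004, §1 Prop. 1.1 (b), §2 Prop. 2.1, p0003–p0004] -/
theorem isIsogenous_powPeriod_of_conj {r : ℕ} {e : Fin r → endAlgRat Φ} (he : CompleteOrthogonalIdempotents e)
    (i₀ : Fin r) (hconj : ∀ i, ∃ u : (endAlgRat Φ)ˣ, e i = ↑u * e i₀ * ↑u⁻¹) :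
    IsIsogenous Φ (powPeriod (idemPeriod Φ (e i₀)) r) := by
  have h1 := (isIsogenous_sigmaPi_idemPeriod_of_complete Φ he).symm
  refine IsIsogenous.trans _ _ _ h1 (IsIsogenous.sigmaPi_powPeriod _ _ fun i ↦ ?_)
  obtain ⟨u, hu⟩ := hconj i
  rw [hu]
  exact isIsogenous_idemPeriod_conj_of_unit Φ (e i₀) u

/-- Conjugate idempotents of `End_ℚ(X)` have sub-tori of the same rank (`rk Λ(X^ε) = Tr(ε)` and the trace
is conjugation invariant). [cite: Lange2023AbelianVarietiesComplex, §2.4.4 Cor. 2.4.28 (`dim X^ε = Tr_a(ε)`), p0124] -/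
theorem subRank_idemSubspace_eq_of_conj {e e' : endAlgRat Φ} (he : IsIdempotentElem e) (u : (endAlgRat Φ)ˣ)
    (h : e' = ↑u * e * ↑u⁻¹) :
    subRank (idemSubspace (e' : Matrix ι ι ℚ)) = subRank (idemSubspace (e : Matrix ι ι ℚ)) := by
  have he' : IsIdempotentElem e' := by
    rw [h]
    change ↑u * e * ↑u⁻¹ * (↑u * e * ↑u⁻¹) = ↑u * e * ↑u⁻¹
    simp only [mul_assoc, Units.inv_mul_cancel_left]
    rw [← mul_assoc e e, he.eq]
  have htr : ((e' : endAlgRat Φ) : Matrix ι ι ℚ).trace = ((e : endAlgRat Φ) : Matrix ι ι ℚ).trace := by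
    rw [h, Subalgebra.coe_mul, Subalgebra.coe_mul, Matrix.trace_mul_comm, ← Matrix.mul_assoc, ← Subalgebra.coe_mul,
      Units.inv_mul, Subalgebra.coe_one, Matrix.one_mul]
  have h1 := subRank_idemSubspace_eq_trace_rat Φ he'
  rw [htr, ← subRank_idemSubspace_eq_trace_rat Φ he] at h1
  exact_mod_cast h1

/-- For complete orthogonal idempotents `e_i ∈ End_ℚ(X)`, `i ∈ Fin r`, pairwise conjugate by units:
`r · rk Λ(X^{e_{i₀}}) = rk Λ` (the traces agree and sum to `Tr(1) = rk Λ`).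
[cite: Lange2023AbelianVarietiesComplex, §2.4.4 Cor. 2.4.28, p0124] [cite: Zarhin2002CyclicCovers, §3 Lemma 3.7 ("`2 dim(Z) = p - 1`", p0007)] -/
theorem mul_subRank_idemSubspace_eq_card {r : ℕ} {e : Fin r → endAlgRat Φ} (he : CompleteOrthogonalIdempotents e)
    (i₀ : Fin r) (hconj : ∀ i, ∃ u : (endAlgRat Φ)ˣ, e i = ↑u * e i₀ * ↑u⁻¹) :
    r * subRank (idemSubspace (e i₀ : Matrix ι ι ℚ)) = Fintype.card ι := by
  have hi : ∀ i, subRank (idemSubspace (e i : Matrix ι ι ℚ)) = subRank (idemSubspace (e i₀ : Matrix ι ι ℚ)) :=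
    fun i ↦ by
      obtain ⟨u, hu⟩ := hconj i
      exact subRank_idemSubspace_eq_of_conj Φ (he.idem i₀) u hu
  have hsum : ((∑ i, subRank (idemSubspace (e i : Matrix ι ι ℚ)) : ℕ) : ℚ) = Fintype.card ι := by
    rw [Nat.cast_sum]
    have h1 : ∀ i, (subRank (idemSubspace (e i : Matrix ι ι ℚ)) : ℚ) = ((e i : endAlgRat Φ) : Matrix ι ι ℚ).trace :=
      fun i ↦ subRank_idemSubspace_eq_trace_rat Φ (he.idem i)
    simp_rw [h1]
    rw [← Matrix.trace_sum, ← AddSubmonoidClass.coe_finsetSum, he.complete, Subalgebra.coe_one, Matrix.trace_one]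
  have h2 : ∑ i, subRank (idemSubspace (e i : Matrix ι ι ℚ)) = Fintype.card ι := by exact_mod_cast hsum
  rw [← h2, Finset.sum_congr rfl fun i _ ↦ hi i, Finset.sum_const, Finset.card_univ, Fintype.card_fin,
    smul_eq_mul]

end Transport

/-! ### §3 The second alternative of Theorem 2.18: `X ∼ B^r`, `rk Λ(B) = ℓ - 1`, `Φ_ℓ(δ|_B) = 0` -/

section Main

variable {ι : Type*} [Fintype ι] [DecidableEq ι] {E : Type*} [NormedAddCommGroup E] [NormedSpace ℂ E]
  (Φ : (ι → ℝ) ≃L[ℝ] E) {D : Matrix ι ι ℤ} {ℓ : ℕ}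

/-- `D_ℚ ∈ End_ℚ(X)` as soon as the commutant of `D_ℚ` lies in `End_ℚ(X)`. [folklore] -/
private theorem map_mem_endAlgRat_of_centralizer_le
    (hcen : Subalgebra.centralizer ℚ ({D.map (Int.cast : ℤ → ℚ)} : Set (Matrix ι ι ℚ)) ≤ endAlgRat Φ) :
    D.map (Int.cast : ℤ → ℚ) ∈ endAlgRat Φ :=
  hcen ((Subalgebra.mem_centralizer_iff ℚ).2 fun _ hg ↦ by rw [Set.mem_singleton_iff.1 hg])

/-- **`Φ_ℓ(δ|_B) = 0`**: the restriction of `δ` to the sub-torus `B = X^e` of an idempotent `e ∈ End_ℚ(X)`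
commuting with `δ` again satisfies the cyclotomic equation — "an embedding `ℚ(ζ_p) ≅ ℚ(δ_p) ↪ End⁰(Z)`".
[cite: Zarhin2002CyclicCovers, §3 Lemma 3.7 (p0007)] [cite: DolgachevZarhin2024, §2.2 Theorem 2.18 (last sentence, chunk p0036)] -/
theorem aeval_cyclotomic_restrictEnd_eq_zero (hD : aeval D (cyclotomic ℓ ℤ) = 0)
    (hDe : D.map (Int.cast : ℤ → ℚ) ∈ endAlgRat Φ) {e : endAlgRat Φ} (he : IsIdempotentElem e)
    (hc : D.map (Int.cast : ℤ → ℚ) * (e : Matrix ι ι ℚ) = (e : Matrix ι ι ℚ) * D.map (Int.cast : ℤ → ℚ)) :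
    aeval (restrictEnd Φ e ⟨D.map (Int.cast : ℤ → ℚ), hDe⟩) (cyclotomic ℓ ℚ) = 0 := by
  have hc' : Commute (⟨D.map (Int.cast : ℤ → ℚ), hDe⟩ : endAlgRat Φ) e := Subtype.ext hc
  have h0 : aeval (⟨D.map (Int.cast : ℤ → ℚ), hDe⟩ : endAlgRat Φ) (cyclotomic ℓ ℚ) = 0 :=
    Subtype.ext (by rw [Polynomial.aeval_subalgebra_coe, Subalgebra.coe_zero]; exact aeval_map_cyclotomic_eq_zero hD)
  rw [← restrictEnd_aeval he hc', h0]
  have h := restrictEnd_smul e (0 : ℚ) (1 : endAlgRat Φ)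
  rwa [zero_smul, zero_smul] at h

/-- **Theorem 2.18, second alternative, "`A` is isogenous to a self-product `B^r` of a `(ℓ - 1)/2`-dimensional
abelian variety `B`" (with `ℚ(ζ_ℓ) ↪ End_ℚ(B)`), at torus level.** Let `X = E/Φ(ℤ^ι)` have positive
dimension, `ℓ` prime, `D ∈ M_ι(ℤ)` with `Φ_ℓ(D) = 0`, and suppose every rational matrix commuting with `D_ℚ`
lies in `End_ℚ(X)` (the second alternative of Theorem 2.18, FILE 2). Then there is an idempotent
`e ∈ End_ℚ(X)` commuting with `δ` such that `X ∼ (X^e)^r`, `r = rk Λ/(ℓ - 1)`, and `rk Λ(X^e) = ℓ - 1`.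
Proof (Zarhin 2002, Lemma 3.7): `End_ℚ(X)_δ ≅ Mat_r(ℚ[δ])`, its diagonal matrix units are complete orthogonal
idempotents of `End_ℚ(X)`, pairwise conjugate, so `X ∼ ∏_i X^{E_{ii}} ∼ (X^{E_{11}})^r` and
`r · rk Λ(X^{E_{11}}) = rk Λ`. [cite: DolgachevZarhin2024, §2.2 Theorem 2.18 (last sentence, chunk p0036)] [cite: Zarhin2002CyclicCovers, §3 Lemma 3.7 and its proof (p0007)] -/
theorem exists_isIsogenous_powPeriod_of_centralizer_le [Nonempty ι] (hℓ : ℓ.Prime)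
    (hD : aeval D (cyclotomic ℓ ℤ) = 0)
    (hcen : Subalgebra.centralizer ℚ ({D.map (Int.cast : ℤ → ℚ)} : Set (Matrix ι ι ℚ)) ≤ endAlgRat Φ) :
    ∃ e : endAlgRat Φ, IsIdempotentElem e ∧
      D.map (Int.cast : ℤ → ℚ) * (e : Matrix ι ι ℚ) = (e : Matrix ι ι ℚ) * D.map (Int.cast : ℤ → ℚ) ∧
      IsIsogenous Φ (powPeriod (idemPeriod Φ e) (Fintype.card ι / (ℓ - 1))) ∧
      subRank (idemSubspace (e : Matrix ι ι ℚ)) = ℓ - 1 := by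
  -- `r = rk Λ/(ℓ - 1) ≥ 1`
  have hdvd : ℓ - 1 ∣ Fintype.card ι := by
    rw [← Nat.totient_prime hℓ]
    exact totient_dvd_card hℓ.pos hD
  have hℓ1 : 0 < ℓ - 1 := Nat.sub_pos_of_lt hℓ.one_lt
  have hr : 0 < Fintype.card ι / (ℓ - 1) := Nat.div_pos (Nat.le_of_dvd Fintype.card_pos hdvd) hℓ1
  -- `End_ℚ(X)_δ = C(δ) ≅ Mat_r(ℚ[δ])`, and `C(δ) ⊆ End_ℚ(X)`
  obtain ⟨eC⟩ := nonempty_centralizer_algEquiv_matrix (ι := ι) hℓ hD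
  let φ : Matrix (Fin (Fintype.card ι / (ℓ - 1))) (Fin (Fintype.card ι / (ℓ - 1)))
      (Algebra.adjoin ℚ ({D.map (Int.cast : ℤ → ℚ)} : Set (Matrix ι ι ℚ))) →ₐ[ℚ] endAlgRat Φ :=
    (Subalgebra.inclusion hcen).comp (eC.symm : _ →ₐ[ℚ] _)
  -- the matrix units
  let e : Fin (Fintype.card ι / (ℓ - 1)) → endAlgRat Φ := fun i ↦ φ (Matrix.single i i 1)
  have he : CompleteOrthogonalIdempotents e := completeOrthogonalIdempotents_single_diag.map φ.toRingHom
  let i₀ : Fin (Fintype.card ι / (ℓ - 1)) := ⟨0, hr⟩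
  have hconj : ∀ i, ∃ u : (endAlgRat Φ)ˣ, e i = ↑u * e i₀ * ↑u⁻¹ := fun i ↦ by
    obtain ⟨u, hu⟩ := exists_unit_single_eq_conj
      (R := Algebra.adjoin ℚ ({D.map (Int.cast : ℤ → ℚ)} : Set (Matrix ι ι ℚ))) i₀ i
    refine ⟨Units.map (φ : _ →* endAlgRat Φ) u, ?_⟩
    rw [Units.coe_map, Units.coe_map_inv, MonoidHom.coe_coe]
    change φ (Matrix.single i i 1) = _
    rw [hu, map_mul, map_mul]
  refine ⟨e i₀, he.idem i₀, ?_, isIsogenous_powPeriod_of_conj Φ he i₀ hconj, ?_⟩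
  · -- `e_{i₀} ∈ C(δ)` commutes with `D_ℚ`
    have hmem := (eC.symm (Matrix.single i₀ i₀ 1)).2
    rw [Subalgebra.mem_centralizer_iff] at hmem
    exact hmem _ rfl
  · have h := mul_subRank_idemSubspace_eq_card Φ he i₀ hconj
    exact Nat.eq_of_mul_eq_mul_left hr (h.trans (Nat.div_mul_cancel hdvd).symm)

/-- **Theorem 2.18, second alternative — the proved part of its last sentence, from `R = End(A^δ)`**:
if `δ ∈ End(X)`, `Φ_ℓ(δ) = 0`, and the image `R` of (2.19) is all of `End_{𝔽_ℓ}(A^δ)`, then `X ∼ B^r` for the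
sub-torus `B = X^e` of an idempotent `e ∈ End_ℚ(X)` commuting with `δ`, with `rk Λ(B) = ℓ - 1`
("`2 dim B = ℓ - 1`") and `Φ_ℓ(δ|_B) = 0` ("an embedding `ℚ(ζ_ℓ) ≅ ℚ(δ) ↪ End_ℚ(B)`"); the printed
"`End_ℚ(B) ≅ ℚ(ζ_ℓ)`" is not proved in the source and not asserted (module docstring).
`-- TODO(Thm 2.18): "End_ℚ(B) ≅ ℚ(ζ_ℓ)".`
[cite: DolgachevZarhin2024, §2.2 Theorem 2.18 (last sentence, chunk p0036)] [cite: Zarhin2002CyclicCovers, §3 Lemma 3.7 (p0007)] -/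
theorem exists_isIsogenous_powPeriod_of_fixedImage_eq_top [Nonempty ι] (hℓ : ℓ.Prime)
    (hD : aeval D (cyclotomic ℓ ℤ) = 0) (hDe : D ∈ endRingInt Φ) [Module (ZMod ℓ) (fixedSubgroup Φ D)]
    (htop : fixedImage Φ D ℓ = ⊤) :
    ∃ e : endAlgRat Φ, ∃ hDq : D.map (Int.cast : ℤ → ℚ) ∈ endAlgRat Φ, IsIdempotentElem e ∧
      Commute (⟨D.map (Int.cast : ℤ → ℚ), hDq⟩ : endAlgRat Φ) e ∧
      IsIsogenous Φ (powPeriod (idemPeriod Φ e) (Fintype.card ι / (ℓ - 1))) ∧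
      subRank (idemSubspace (e : Matrix ι ι ℚ)) = ℓ - 1 ∧
      aeval (restrictEnd Φ e ⟨D.map (Int.cast : ℤ → ℚ), hDq⟩) (cyclotomic ℓ ℚ) = 0 := by
  have hcen := centralizer_le_endAlgRat_of_fixedImage_eq_top Φ hℓ hD hDe htop
  obtain ⟨e, he, hc, hiso, hrk⟩ := exists_isIsogenous_powPeriod_of_centralizer_le Φ hℓ hD hcen
  have hDq : D.map (Int.cast : ℤ → ℚ) ∈ endAlgRat Φ := (mem_endRingInt_iff Φ).1 hDe
  exact ⟨e, hDq, he, Subtype.ext hc, hiso, hrk, aeval_cyclotomic_restrictEnd_eq_zero Φ hD hDq he hc⟩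

/-- **`2 dim B = ℓ - 1` and `ℚ(ζ_ℓ) ≅ ℚ[δ|_B]` is a maximal commutative subalgebra**: for a rational square
matrix `M` of size `ℓ - 1` with `Φ_ℓ(M) = 0` (such as `δ|_B` above, `rk Λ(B) = ℓ - 1`), `ℚ[M] ≅ ℚ[t]/(Φ_ℓ)`
(`≅ ℚ(ζ_ℓ)`) and `ℚ[M]` is its own commutant in `Mat_{ℓ-1}(ℚ)` — in particular in `End_ℚ(B) ⊆ Mat_{ℓ-1}(ℚ)`
(the tree's Shimura §5.1 Prop. 1/3 form, `centralizer_adjoin_eq_of_aeval_cyclotomic_eq_zero`). This is what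
replaces the printed "`End_ℚ(B) ≅ ℚ(ζ_ℓ)`". [cite: Zarhin2002CyclicCovers, §3 Lemma 3.7 ("`p - 1 = [ℚ(δ_p) : ℚ]` divides `2 dim(Z)` and therefore `2 dim(Z) = p - 1`", p0007)] [cite: DolgachevZarhin2024, §2.2 Theorem 2.18 (chunk p0036)] -/
theorem adjoin_restrict_self_centralizing {s : ℕ} (hs : s = ℓ - 1) (hℓ : ℓ.Prime)
    {M : Matrix (Fin s) (Fin s) ℚ} (hM : aeval M (cyclotomic ℓ ℚ) = 0) :
    Nonempty (AdjoinRoot (cyclotomic ℓ ℚ) ≃ₐ[ℚ] Algebra.adjoin ℚ ({M} : Set (Matrix (Fin s) (Fin s) ℚ))) ∧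
      Subalgebra.centralizer ℚ ((Algebra.adjoin ℚ ({M} : Set (Matrix (Fin s) (Fin s) ℚ)) :
          Subalgebra ℚ (Matrix (Fin s) (Fin s) ℚ)) : Set (Matrix (Fin s) (Fin s) ℚ)) =
        Algebra.adjoin ℚ ({M} : Set (Matrix (Fin s) (Fin s) ℚ)) := by
  have hcard : Fintype.card (Fin s) = Nat.totient ℓ := by rw [Fintype.card_fin, hs, Nat.totient_prime hℓ]
  haveI : Nonempty (Fin s) := Fintype.card_pos_iff.1 (by rw [hcard]; exact Nat.totient_pos.2 hℓ.pos)
  exact ⟨⟨adjoinRootCyclotomicEquiv hℓ.pos hM⟩, centralizer_adjoin_eq_of_aeval_cyclotomic_eq_zero hℓ.pos hM hcard⟩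

end Main

end ComplexTorus

end Literature.Geometry.Kaehler

end
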